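import Literature.Probability.Percolation.DecisionTreeThreeConfig
import Mathlib.Algebra.BigOperators.Fin
import HarnessLib

/-!
# Switching certificates are fibre certificates

Helper file for crux `stmt-CriticalPhenomena-4575` (`NoHeavyLowerTail`), new-inequality factory seat
`prim-ineq-gen-1` (gen 5), FINDING-11.  Everything here is PROVED.

A three-copy switching `Φ` (an edgewise copy-permuting self-map of the triples of configurations inside
`D`, `DecisionTree.PermutesCopies`, injective on `DecisionTree.triples D` — every sealed exploration program
of [Gladkov–Zimin, Lemma 4.2] and its three-copy forms `swap3`, `splice3` is of this kind) does not only
preserve the product law `μ ⊗ μ ⊗ μ` (`DecisionTree.sum_wt3W_comp_eq_of_injOn`): since a permutation of three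
bits preserves their sum, it preserves the PROFILE `e ↦ #{copies containing e}` of a triple, hence it is a
bijection of every FIBRE (set of triples with a given profile) onto itself (`sum_fibre_comp_eq_of_injOn`).

Consequently the certificate principle of [Gladkov–Zimin, §5] holds fibre by fibre
(`fibre_certificate_nonpos`): if potentials `lam0` on the input triple and `lam b` on the outputs of finitely
many switchings sum to `≤ 0` POINTWISE, then for EVERY profile `k` the fibre sum of `lam0 + Σ_b lam b` is
`≤ 0`.  When the potentials are functions of connectivity types whose copy-symmetrised cubic form is `−F`,
this says that every three-copy fibre sum of the kernel of `F` is `≥ 0` — the coefficientwise ("comb")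
positivity `M(F)` of the factory notes — which is strictly more than `F ≥ 0` on product measures (the latter
is recovered by weighting the fibres with the nonnegative fibre monomials, cf. `ThreeCopy.cubicForm_nonneg_of_fibres`).
Instance: the refereed switching certificates for `F = SHK3⁺ = (1+t)(qt − e₂) − e₃` (prim-lit-2, PROOF-3PTLB)
therefore prove fibre positivity of `SHK3⁺` on every finite graph.
-/

namespace Summit.CriticalPhenomena.PercolationContinuityZ3.Theorems

namespace FibreSwitching

open Finset
open Literature.Probability.Percolation.DecisionTree

noncomputable section

open Classical

variable {ι : Type*} [DecidableEq ι]

/-- The profile of a triple of configurations: the number of copies in which the coordinate `e` is open. -/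
def profile (x : Fin 3 → Finset ι) (e : ι) : ℕ := ∑ k : Fin 3, if e ∈ x k then 1 else 0

/-- The fibre of the profile `k` inside the triples of configurations in `D`. -/
def fibre (D : Finset ι) (k : ι → ℕ) : Finset (Fin 3 → Finset ι) :=
  (triples D).filter (fun x => profile x = k)

/-- Fibres consist of triples inside `D`. -/
theorem fibre_subset (D : Finset ι) (k : ι → ℕ) : fibre D k ⊆ triples D := filter_subset _ _

/-- Every triple inside `D` lies in the fibre of its own profile. -/
theorem mem_fibre_self {D : Finset ι} {x : Fin 3 → Finset ι} (hx : x ∈ triples D) :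
    x ∈ fibre D (profile x) := mem_filter.2 ⟨hx, rfl⟩

/-- **An edgewise copy-permuting map preserves the profile** (a permutation of three bits preserves their sum). -/
theorem profile_eq_of_permutesCopies {Φ : (Fin 3 → Finset ι) → (Fin 3 → Finset ι)}
    (hΦ : PermutesCopies Φ) (x : Fin 3 → Finset ι) : profile (Φ x) = profile x := by
  funext e
  obtain ⟨π, hπ⟩ := hΦ x e
  unfold profile
  calc ∑ k : Fin 3, (if e ∈ Φ x k then 1 else 0)
      = ∑ k : Fin 3, (if e ∈ x (π k) then 1 else 0) := sum_congr rfl fun k _ => by simp only [hπ k]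
    _ = ∑ k : Fin 3, (if e ∈ x k then 1 else 0) := Equiv.sum_comp π (fun k => if e ∈ x k then 1 else 0)

/-- An injective edgewise copy-permuting self-map of the triples inside `D` maps every fibre into itself. -/
theorem mapsTo_fibre {Φ : (Fin 3 → Finset ι) → (Fin 3 → Finset ι)} (hΦ : PermutesCopies Φ)
    {D : Finset ι} (hmaps : ∀ x ∈ triples D, Φ x ∈ triples D) (k : ι → ℕ) :
    ∀ x ∈ fibre D k, Φ x ∈ fibre D k := by
  intro x hx
  rcases mem_filter.1 hx with ⟨hxD, hxk⟩
  exact mem_filter.2 ⟨hmaps x hxD, (profile_eq_of_permutesCopies hΦ x).trans hxk⟩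

/-- **Switchings are bijections of every fibre**: for an injective edgewise copy-permuting self-map `Φ` of
the triples inside `D` and every profile `k`, `Σ_{x ∈ fibre k} f (Φ x) = Σ_{x ∈ fibre k} f x`. -/
theorem sum_fibre_comp_eq_of_injOn {Φ : (Fin 3 → Finset ι) → (Fin 3 → Finset ι)}
    (hΦ : PermutesCopies Φ) {D : Finset ι} (hmaps : ∀ x ∈ triples D, Φ x ∈ triples D)
    (hinj : Set.InjOn Φ (triples D)) (k : ι → ℕ) {M : Type*} [AddCommMonoid M]
    (f : (Fin 3 → Finset ι) → M) :
    ∑ x ∈ fibre D k, f (Φ x) = ∑ x ∈ fibre D k, f x := by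
  have hmapsF : ∀ x ∈ fibre D k, Φ x ∈ fibre D k := mapsTo_fibre hΦ hmaps k
  have hmapsF' : Set.MapsTo Φ (fibre D k) (fibre D k) := fun x hx => hmapsF x hx
  have hinjF : Set.InjOn Φ (fibre D k) := hinj.mono (by
    intro x hx
    exact fibre_subset D k (by exact_mod_cast hx))
  have hsurjF : Set.SurjOn Φ (fibre D k) (fibre D k) :=
    Finset.surjOn_of_injOn_of_card_le Φ hmapsF' hinjF le_rfl
  exact Finset.sum_nbij Φ hmapsF hinjF hsurjF fun x _ => rfl

/-- **Fibre certificate principle.**  Let `Φ b` (`b ∈ s`) be injective edgewise copy-permuting self-maps of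
the triples inside `D`, `code` any function of a triple (e.g. the triple of terminal-connectivity types) and
`lam0`, `lam b` real potentials.  If POINTWISE `lam0 (code x) + Σ_b lam b (code (Φ b x)) ≤ 0` for every
triple `x` inside `D`, then for EVERY profile `k` the fibre sum `Σ_{x ∈ fibre k} (lam0 (code x) + Σ_b lam b (code x))`
is `≤ 0` (not only its `μ^{⊗3}`-expectation, `DecisionTree.DTree3.certificate_sum_nonpos`). -/
theorem fibre_certificate_nonpos (D : Finset ι) {K : Type*} (code : (Fin 3 → Finset ι) → K)
    (lam0 : K → ℝ) {β : Type*} (s : Finset β) (Φ : β → (Fin 3 → Finset ι) → (Fin 3 → Finset ι))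
    (hΦ : ∀ b ∈ s, PermutesCopies (Φ b)) (hmaps : ∀ b ∈ s, ∀ x ∈ triples D, Φ b x ∈ triples D)
    (hinj : ∀ b ∈ s, Set.InjOn (Φ b) (triples D)) (lam : β → K → ℝ)
    (hpt : ∀ x ∈ triples D, lam0 (code x) + ∑ b ∈ s, lam b (code (Φ b x)) ≤ 0) (k : ι → ℕ) :
    ∑ x ∈ fibre D k, (lam0 (code x) + ∑ b ∈ s, lam b (code x)) ≤ 0 := by
  have hswap : ∀ b ∈ s, ∑ x ∈ fibre D k, lam b (code (Φ b x)) = ∑ x ∈ fibre D k, lam b (code x) :=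
    fun b hb => sum_fibre_comp_eq_of_injOn (hΦ b hb) (hmaps b hb) (hinj b hb) k (fun x => lam b (code x))
  have hrew : ∑ x ∈ fibre D k, (lam0 (code x) + ∑ b ∈ s, lam b (code x)) =
      ∑ x ∈ fibre D k, (lam0 (code x) + ∑ b ∈ s, lam b (code (Φ b x))) := by
    simp only [sum_add_distrib]
    congr 1
    rw [sum_comm, sum_comm (s := fibre D k)]
    exact sum_congr rfl fun b hb => (hswap b hb).symm
  rw [hrew]
  exact sum_nonpos fun x hx => hpt x (fibre_subset D k hx)

/-- The triples inside `D` are the disjoint union of the fibres, so a fibrewise statement refines the total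
one: `Σ_{x ∈ triples D} g x = Σ_{k ∈ profiles} Σ_{x ∈ fibre k} g x` over the finitely many realised profiles. -/
theorem sum_triples_eq_sum_fibres (D : Finset ι) {M : Type*} [AddCommMonoid M] (g : (Fin 3 → Finset ι) → M) :
    ∑ x ∈ triples D, g x = ∑ k ∈ (triples D).image profile, ∑ x ∈ fibre D k, g x := by
  rw [← sum_fiberwise_of_maps_to (g := profile) (fun x hx => mem_image_of_mem profile hx)]
  rfl

end

end FibreSwitching

end Summit.CriticalPhenomena.PercolationContinuityZ3.Theorems

/-! ## From fibres to laws: the product weight is a function of the profile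

The weight `wt3W D p x = Π_e p_e^{k_e} (1 − p_e)^{3 − k_e}` of a triple depends on `x` only through its profile
`k = profile x`; hence a fibrewise inequality `Σ_{fibre k} g ≥ 0` (for every `k`) implies the law-level one
`Σ_x wt3W x · g x ≥ 0` for EVERY `p ∈ [0,1]^ι` (the abstract form of `ThreeCopy.cubicForm_nonneg_of_fibres`,
here in the `DecisionTree` vocabulary in which the switching certificates live). -/

namespace Summit.CriticalPhenomena.PercolationContinuityZ3.Theorems

namespace FibreSwitching

open Finset
open Literature.Probability.Percolation.DecisionTree

noncomputable section

open Classical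

variable {ι : Type*} [DecidableEq ι]

/-- The fibre monomial of a profile `k`: `Π_{e ∈ D} p_e^{k e} (1 − p_e)^{3 − k e}`. -/
def wprof (D : Finset ι) (p : ι → ℝ) (k : ι → ℕ) : ℝ := ∏ e ∈ D, p e ^ k e * (1 - p e) ^ (3 - k e)

omit [DecidableEq ι] in
/-- Fibre monomials are nonnegative on the cube. -/
theorem wprof_nonneg (D : Finset ι) {p : ι → ℝ} (hp0 : ∀ i, 0 ≤ p i) (hp1 : ∀ i, p i ≤ 1) (k : ι → ℕ) :
    0 ≤ wprof D p k :=
  prod_nonneg fun e _ => mul_nonneg (pow_nonneg (hp0 e) _) (pow_nonneg (sub_nonneg.2 (hp1 e)) _)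

/-- At one coordinate the three factors multiply to `q^{#copies containing e} (1−q)^{3 − #}`. -/
theorem prod_fin3_profile (p : ι → ℝ) (x : Fin 3 → Finset ι) (e : ι) :
    ∏ i : Fin 3, (if e ∈ x i then p e else 1 - p e) = p e ^ profile x e * (1 - p e) ^ (3 - profile x e) := by
  unfold profile
  rw [Fin.prod_univ_three, Fin.sum_univ_three]
  by_cases h0 : e ∈ x 0 <;> by_cases h1 : e ∈ x 1 <;> by_cases h2 : e ∈ x 2 <;>
    simp only [h0, h1, h2, ↓reduceIte, Nat.reduceAdd, Nat.reduceSub, pow_zero, pow_one, one_mul, mul_one] <;> ring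

/-- **The product weight of a triple is the fibre monomial of its profile.** -/
theorem wt3W_eq_wprof (D : Finset ι) (p : ι → ℝ) (x : Fin 3 → Finset ι) :
    wt3W D p x = wprof D p (profile x) := by
  unfold wt3W Literature.Probability.Percolation.DecisionTree.wtW wprof
  rw [Finset.prod_comm]
  exact prod_congr rfl fun e _ => prod_fin3_profile p x e

/-- Regrouping the law-level sum by fibres: `Σ_x wt3W x · g x = Σ_k wprof k · Σ_{fibre k} g`. -/
theorem sum_wt3W_mul_eq_sum_fibres (D : Finset ι) (p : ι → ℝ) (g : (Fin 3 → Finset ι) → ℝ) :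
    ∑ x ∈ triples D, wt3W D p x * g x =
      ∑ k ∈ (triples D).image profile, wprof D p k * ∑ x ∈ fibre D k, g x := by
  rw [sum_triples_eq_sum_fibres]
  refine sum_congr rfl fun k _ => ?_
  rw [mul_sum]
  refine sum_congr rfl fun x hx => ?_
  rw [wt3W_eq_wprof, (mem_filter.1 hx).2]

/-- **Fibre positivity implies law positivity for every product weight.**  If every fibre sum of `g` is
`≥ 0` then `Σ_x wt3W D p x · g x ≥ 0` for all `p ∈ [0,1]^ι`. -/
theorem sum_wt3W_mul_nonneg_of_fibres (D : Finset ι) {p : ι → ℝ} (hp0 : ∀ i, 0 ≤ p i) (hp1 : ∀ i, p i ≤ 1)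
    (g : (Fin 3 → Finset ι) → ℝ) (hfib : ∀ k, 0 ≤ ∑ x ∈ fibre D k, g x) :
    0 ≤ ∑ x ∈ triples D, wt3W D p x * g x := by
  rw [sum_wt3W_mul_eq_sum_fibres]
  exact sum_nonneg fun k _ => mul_nonneg (wprof_nonneg D hp0 hp1 k) (hfib k)

/-- **Fibre certificate ⟹ law-level certificate for every weight** (recovers
`DecisionTree.DTree3.certificate_sum_nonpos` for copy-permuting bijections, via the fibres). -/
theorem certificate_sum_nonpos_of_fibres (D : Finset ι) {p : ι → ℝ} (hp0 : ∀ i, 0 ≤ p i) (hp1 : ∀ i, p i ≤ 1)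
    {K : Type*} (code : (Fin 3 → Finset ι) → K) (lam0 : K → ℝ) {β : Type*} (s : Finset β)
    (Φ : β → (Fin 3 → Finset ι) → (Fin 3 → Finset ι)) (hΦ : ∀ b ∈ s, PermutesCopies (Φ b))
    (hmaps : ∀ b ∈ s, ∀ x ∈ triples D, Φ b x ∈ triples D) (hinj : ∀ b ∈ s, Set.InjOn (Φ b) (triples D))
    (lam : β → K → ℝ) (hpt : ∀ x ∈ triples D, lam0 (code x) + ∑ b ∈ s, lam b (code (Φ b x)) ≤ 0) :
    ∑ x ∈ triples D, wt3W D p x * (lam0 (code x) + ∑ b ∈ s, lam b (code x)) ≤ 0 := by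
  have h := sum_wt3W_mul_nonneg_of_fibres D hp0 hp1 (fun x => -(lam0 (code x) + ∑ b ∈ s, lam b (code x)))
    (fun k => by
      have := fibre_certificate_nonpos D code lam0 s Φ hΦ hmaps hinj lam hpt k
      rw [sum_neg_distrib]; exact neg_nonneg.mpr this)
  have e : ∑ x ∈ triples D, wt3W D p x * -(lam0 (code x) + ∑ b ∈ s, lam b (code x)) =
      -∑ x ∈ triples D, wt3W D p x * (lam0 (code x) + ∑ b ∈ s, lam b (code x)) := by
    rw [← sum_neg_distrib]; exact sum_congr rfl fun x _ => mul_neg _ _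
  rw [e] at h
  exact neg_nonneg.mp h

end

end FibreSwitching

end Summit.CriticalPhenomena.PercolationContinuityZ3.Theorems
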